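import Literature.Combinatorics.SimpleGraph.LovaszThetaFWCorrect
import HarnessLib

/-!
# The saturated (fixed-width) model of the integer Frank–Wolfe algorithm for `ϑ`

Topic `Combinatorics/SimpleGraph`, continuing `LovaszThetaFWAlgorithm.lean` / `LovaszThetaFWCorrect.lean`.
A polynomial-time string machine realising `ThetaFW` (towards the discharge of
`Literature.Computability.Complexity.GLS1981_thetaApprox_unary_FP`) must bound the length of every
intermediate string on EVERY input, malformed ones included; as for the tree's LLL machine
(`Algebra/EuclideanLattices/LLLCapModel.lean`) this is achieved by **saturating** every matrix entry
it produces at a width `W` (`capZ W z = z` if `|z| < 2ᵂ`, else `0`; the brick `zcapF` of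
`Computability/Complexity/ZIntBricks.lean` computes exactly this at `W = |yardstick|`). This file
DEFINES the saturated recursion the machine computes literally —

* `gradCap` — the shifted gradient `gradInt` with entries saturated;
* `powCap W N j` — `j` rounds of `P ↦ capM W (A ⊛ P)` from `P = 1`, where `A = gradCap W N` and
  `(X ⊛ Y)ᵢₖ = Σₗ Xᵢₗ Yₖₗ` (`mulRR`, the row-by-row product a machine streaming two row-major
  matrices computes; it is `X * Y` for symmetric `Y`, `mulRR_eq_mul`);
* `stepCap`, `iterCap`, `thetaZCap` — the Frank–Wolfe step with the oracle `powCap W N r`, its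
  entries saturated, the iteration from `1`, and the output `⌈outNum/(8τ²)⌉`;

and PROVES that **saturation never takes effect at polynomial width**: with
`G = (2ᵖ + n²)(1 + c₀) + 2M(2ᵖ + n + 1)` (`cG`, a bound for the entries of `gradInt` along the run,
`abs_gradInt_le`), `‖Aʲ‖∞ ≤ (nG)ʲ` (`abs_pow_gradInt_le`), `G ≤ 2^{p+7n+m+5}` (`cG_le_two_pow`) and the
width `cW = r(n + p + 7n + m + 6) + 1` (`cW`; polynomial in `n` and `m` — NOT in `log m`: the power
exponent `r = qk` is polynomial in `m`, which is why the accuracy parameter is taken in unary), for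
every `W ≥ cW`: `powCap W Nₜ j = Aₜʲ` (`j ≤ r`), `iterCap W t = fwIter t` (`iterCap_eq`) and
`thetaZCap W = thetaZ` (`thetaZCap_eq`), whence (`thetaZCap_toNat_spec`) the saturated output
satisfies `m ϑ(H) ≤ z ≤ m ϑ(H) + 2` (`n, m ≥ 1`).

## References

* M. Jaggi, arXiv:1108.1170 (2011), Alg. 6, Thm. 17–18 [Jaggi2011].
* A. K. Lenstra, H. W. Lenstra, L. Lovász, Math. Ann. 261 (1982), Prop. 1.26 (the fixed-width
  discipline of a polynomial-time integer algorithm) [LenstraLenstraLovasz1982].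
* S. Arora, B. Barak, *Computational Complexity* (2009), §1.3 [AroraBarakCC2009].
-/

noncomputable section

open Matrix Finset

namespace Literature.Combinatorics.SimpleGraph

namespace ThetaFW

variable (n m : ℕ) (H : _root_.SimpleGraph (Fin n)) [DecidableRel H.Adj]

/-! ### Saturation and the saturated recursion -/

/-- **Saturation at width `W`**: `z` if `|z| < 2ᵂ`, else `0` — the value of the brick `zcapF`
(`ZIntBricks.zcapF_dpEnc`), and definitionally the `capZ` of
`Literature/Algebra/EuclideanLattices/LLLCapModel.lean` (kept local so that the graph-theoretic
analysis does not import the lattice development; a machine file importing both identifies them by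
`rfl`). [folklore] -/
def capZ (W : ℕ) (z : ℤ) : ℤ := if z.natAbs < 2 ^ W then z else 0

/-- Entrywise saturation of an integer matrix. [folklore] -/
def capM (W : ℕ) (X : Matrix (Fin n) (Fin n) ℤ) : Matrix (Fin n) (Fin n) ℤ := fun i j => capZ W (X i j)

/-- The **row-by-row product** `(X ⊛ Y)ᵢₖ = Σₗ Xᵢₗ Yₖₗ = (X Yᵀ)ᵢₖ`. [folklore] -/
def mulRR (X Y : Matrix (Fin n) (Fin n) ℤ) : Matrix (Fin n) (Fin n) ℤ := fun i k => ∑ l, X i l * Y k l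

/-- The saturated shifted gradient. [folklore] -/
def gradCap (W : ℕ) (N : Matrix (Fin n) (Fin n) ℤ) : Matrix (Fin n) (Fin n) ℤ :=
  capM n W (gradInt n m H N)

/-- The saturated power loop: `P₀ = 1`, `Pⱼ₊₁ = capM W (A ⊛ Pⱼ)` with `A = gradCap W N`.
[cite: Jaggi2011, §4, Thm. 18 (chunk p0022)] -/
def powCap (W : ℕ) (N : Matrix (Fin n) (Fin n) ℤ) : ℕ → Matrix (Fin n) (Fin n) ℤ
  | 0 => 1
  | j + 1 => capM n W (mulRR n (gradCap n m H W N) (powCap W N j))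

/-- The saturated Frank–Wolfe step: `fwStep` with the oracle matrix `powCap W N r`, entries
saturated. [cite: Jaggi2011, Alg. 6 (chunk p0020)] -/
def stepCap (W : ℕ) (t : ℕ) (N : Matrix (Fin n) (Fin n) ℤ) : Matrix (Fin n) (Fin n) ℤ :=
  capM n W fun i j =>
    stepNum n m t N (powCap n m H W N (cr n m)) i j / stepDen n t N (powCap n m H W N (cr n m)) +
      if i = j then (n : ℤ) else 0

/-- The saturated iteration from `N₀ = 1`. [cite: Jaggi2011, Alg. 6 (chunk p0020)] -/
def iterCap (W : ℕ) : ℕ → Matrix (Fin n) (Fin n) ℤ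
  | 0 => 1
  | t + 1 => stepCap n m H W t (iterCap W t)

/-- The output of the saturated run: `⌈outNum/(8τ²)⌉` at the final state. [folklore] -/
def thetaZCap (W : ℕ) : ℤ :=
  ceilDiv (outNum n m H (iterCap n m H W (cT n m))) (8 * (iterCap n m H W (cT n m)).trace ^ 2)

/-- The entry bound `G = (2ᵖ + n²)(1 + c₀) + 2M(2ᵖ + n + 1)` of the shifted gradient along the run.
[folklore] -/
def cG : ℕ := (2 ^ cp n m + n ^ 2) * (1 + c0 n m) + 2 * cM n m * (2 ^ cp n m + n + 1)

/-- **The width** `cW = r (n + p + 7n + m + 6) + 1` (then `(nG)ʳ < 2^{cW}`). [folklore] -/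
def cW : ℕ := cr n m * (n + (cp n m + 7 * n + m + 6)) + 1

variable {n m H}

/-! ### Saturation is the identity on short integers -/

/-- From an integer bound: `|z| ≤ B < 2ᵂ` gives `z.natAbs < 2ᵂ`. [folklore] -/
theorem natAbs_lt_of_abs_le {z B : ℤ} {W : ℕ} (h : |z| ≤ B) (hB : B < 2 ^ W) : z.natAbs < 2 ^ W := by
  have h1 : ((z.natAbs : ℕ) : ℤ) < ((2 ^ W : ℕ) : ℤ) := by
    rw [Int.natCast_natAbs]; push_cast; exact lt_of_le_of_lt h hB
  exact_mod_cast h1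

/-- `capM W X = X` when all entries are bounded by some `B < 2ᵂ`. [folklore] -/
theorem capM_of_abs_le {W : ℕ} {X : Matrix (Fin n) (Fin n) ℤ} {B : ℤ} (h : ∀ i j, |X i j| ≤ B)
    (hB : B < 2 ^ W) : capM n W X = X := by
  ext i j
  exact if_pos (natAbs_lt_of_abs_le (h i j) hB)

/-- **The row-by-row product is the product for a symmetric right factor.** [folklore] -/
theorem mulRR_eq_mul {X Y : Matrix (Fin n) (Fin n) ℤ} (hY : Y.IsSymm) : mulRR n X Y = X * Y := by
  ext i k
  simp only [mulRR, Matrix.mul_apply]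
  refine sum_congr rfl fun l _ => ?_
  have h := congrFun (congrFun hY l) k
  simp only [Matrix.transpose_apply] at h
  rw [h]

/-- Sup-norm of a product: `|(X * Y)ᵢₖ| ≤ n a b` if `|Xᵢⱼ| ≤ a`, `|Yᵢⱼ| ≤ b`. [folklore] -/
theorem abs_mul_apply_le {X Y : Matrix (Fin n) (Fin n) ℤ} {a b : ℤ} (ha : ∀ i j, |X i j| ≤ a)
    (hb : ∀ i j, |Y i j| ≤ b) (i k : Fin n) : |(X * Y) i k| ≤ n * a * b := by
  have ha0 : 0 ≤ a := (abs_nonneg _).trans (ha i k)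
  rw [Matrix.mul_apply]
  calc |∑ l, X i l * Y l k| ≤ ∑ l, |X i l * Y l k| := abs_sum_le_sum_abs _ _
    _ ≤ ∑ _l : Fin n, a * b := sum_le_sum fun l _ => by
        rw [abs_mul]; exact mul_le_mul (ha i l) (hb l k) (abs_nonneg _) ha0
    _ = n * a * b := by rw [sum_const, card_univ, Fintype.card_fin, nsmul_eq_mul, mul_assoc]

/-! ### Bounds along the true run -/

/-- The trace of every iterate is at most `2ᵖ + n²` (and positive). [folklore] -/
theorem trace_fwIter_le (hn : 1 ≤ n) (hm : 1 ≤ m) :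
    ∀ t, (fwIter n m H t).trace ≤ 2 ^ cp n m + n ^ 2
  | 0 => by
    rw [fwIter, trace_one, Fintype.card_fin]
    have h2 : (0 : ℤ) < 2 ^ cp n m := pow_pos (by norm_num) _
    nlinarith
  | t + 1 => by
    obtain ⟨hpsd, hτ, -⟩ := fwIter_good (H := H) hn hm t
    obtain ⟨-, ⟨-, h⟩, -, -⟩ := fwStep_good (H := H) hn hm t (isSymm_fwIter t) hpsd hτ
    have h' : ((fwStep n m H t (fwIter n m H t)).trace : ℝ) ≤ ((2 ^ cp n m + n ^ 2 : ℤ) : ℝ) := by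
      push_cast; exact h
    rw [fwIter]
    exact_mod_cast h'

/-- **Entries of the shifted gradient along the run are bounded by `G`.** [folklore] -/
theorem abs_gradInt_le (hn : 1 ≤ n) (hm : 1 ≤ m) (t : ℕ) (i j : Fin n) :
    |gradInt n m H (fwIter n m H t) i j| ≤ (cG n m : ℤ) := by
  obtain ⟨-, hτ, hN⟩ := fwIter_good (H := H) hn hm t
  have hτle := trace_fwIter_le (H := H) hn hm t
  set N := fwIter n m H t with hNdef
  have hτabs : |N.trace| ≤ 2 ^ cp n m + n ^ 2 := by rw [abs_of_pos hτ]; exact hτle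
  have hc0 : (0 : ℤ) ≤ (c0 n m : ℤ) := Int.natCast_nonneg _
  have hM0 : (0 : ℤ) ≤ (cM n m : ℤ) := Int.natCast_nonneg _
  have h1 : |(if H.Adj i j then 2 * (cM n m : ℤ) * N i j else 0)| ≤ 2 * (cM n m : ℤ) * (2 ^ cp n m + n + 1) := by
    split_ifs
    · rw [abs_mul, abs_of_nonneg (by positivity)]
      exact mul_le_mul_of_nonneg_left (hN i j) (by positivity)
    · rw [abs_zero]; positivity
  have h2 : |(if i = j then N.trace * (c0 n m : ℤ) else 0)| ≤ (2 ^ cp n m + n ^ 2) * (c0 n m : ℤ) := by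
    split_ifs
    · rw [abs_mul, abs_of_nonneg hc0]
      exact mul_le_mul_of_nonneg_right hτabs hc0
    · rw [abs_zero]; positivity
  unfold gradInt
  calc |N.trace - (if H.Adj i j then 2 * (cM n m : ℤ) * N i j else 0) +
        (if i = j then N.trace * (c0 n m : ℤ) else 0)|
      ≤ |N.trace - (if H.Adj i j then 2 * (cM n m : ℤ) * N i j else 0)| +
        |(if i = j then N.trace * (c0 n m : ℤ) else 0)| := abs_add_le _ _
    _ ≤ (|N.trace| + |(if H.Adj i j then 2 * (cM n m : ℤ) * N i j else 0)|) +
        |(if i = j then N.trace * (c0 n m : ℤ) else 0)| := add_le_add (abs_sub _ _) le_rfl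
    _ ≤ ((2 ^ cp n m + n ^ 2) + 2 * (cM n m : ℤ) * (2 ^ cp n m + n + 1)) +
        (2 ^ cp n m + n ^ 2) * (c0 n m : ℤ) := add_le_add (add_le_add hτabs h1) h2
    _ = (cG n m : ℤ) := by simp only [cG]; push_cast; ring

/-- **Entries of the powers of the shifted gradient**: `|(Aʲ)ᵢₖ| ≤ (nG)ʲ`. [folklore] -/
theorem abs_pow_gradInt_le (hn : 1 ≤ n) (hm : 1 ≤ m) (t : ℕ) :
    ∀ (j : ℕ) (i k : Fin n), |(gradInt n m H (fwIter n m H t) ^ j) i k| ≤ ((n : ℤ) * cG n m) ^ j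
  | 0, i, k => by
    rw [pow_zero, pow_zero, Matrix.one_apply]
    split_ifs <;> simp
  | j + 1, i, k => by
    rw [pow_succ']
    calc |(gradInt n m H (fwIter n m H t) * gradInt n m H (fwIter n m H t) ^ j) i k|
        ≤ n * (cG n m : ℤ) * ((n : ℤ) * cG n m) ^ j :=
          abs_mul_apply_le (abs_gradInt_le hn hm t) (abs_pow_gradInt_le hn hm t j) i k
      _ = ((n : ℤ) * cG n m) ^ (j + 1) := by ring

/-! ### The width is large enough -/

/-- `n² + n + 1 ≤ 2ᵖ` in `ℕ`. [folklore] -/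
theorem quad_le_two_pow_cp_nat (hn : 1 ≤ n) (hm : 1 ≤ m) : n ^ 2 + n + 1 ≤ 2 ^ cp n m := by
  have h := quad_le_two_pow_cp (n := n) (m := m) hn hm
  have h' : ((n ^ 2 + n + 1 : ℕ) : ℝ) ≤ ((2 ^ cp n m : ℕ) : ℝ) := by push_cast; exact h
  exact_mod_cast h'

/-- **`G ≤ 2^{p + 7n + m + 5}`** (`G ≤ 2ᵖ⁺¹(1 + c₀ + 2M) ≤ 2ᵖ⁺¹ · 3c₀ ≤ 2ᵖ⁺¹ · 9n⁷m` and `n ≤ 2ⁿ`,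
`m ≤ 2ᵐ`). [folklore] -/
theorem cG_le_two_pow (hn : 1 ≤ n) (hm : 1 ≤ m) : cG n m ≤ 2 ^ (cp n m + 7 * n + m + 5) := by
  have hq := quad_le_two_pow_cp_nat (n := n) (m := m) hn hm
  have hP1 : 2 ^ cp n m + n ^ 2 ≤ 2 * 2 ^ cp n m := by nlinarith
  have hP2 : 2 ^ cp n m + n + 1 ≤ 2 * 2 ^ cp n m := by nlinarith
  have hM1 : 1 ≤ cM n m := one_le_cM hn hm
  -- `c₀ ≤ 3 n⁷ m` and `1 + c₀ + 2M ≤ 3 c₀`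
  have hc0 : c0 n m ≤ 3 * (n ^ 7 * m) := by
    have : c0 n m = n * (1 + 2 * cM n m) := rfl
    have hM : cM n m = n ^ 6 * m := rfl
    rw [this, hM]
    have : 1 ≤ n ^ 6 * m := hM ▸ hM1
    nlinarith
  have hsum : 1 + c0 n m + 2 * cM n m ≤ 3 * c0 n m := by
    have : c0 n m = n * (1 + 2 * cM n m) := rfl
    nlinarith
  have hn2 : n ≤ 2 ^ n := Nat.lt_two_pow_self.le
  have hm2 : m ≤ 2 ^ m := Nat.lt_two_pow_self.le
  have hn7 : n ^ 7 ≤ 2 ^ (7 * n) := by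
    rw [pow_mul']
    exact Nat.pow_le_pow_left hn2 7
  calc cG n m = (2 ^ cp n m + n ^ 2) * (1 + c0 n m) + 2 * cM n m * (2 ^ cp n m + n + 1) := rfl
    _ ≤ (2 * 2 ^ cp n m) * (1 + c0 n m) + 2 * cM n m * (2 * 2 ^ cp n m) :=
        add_le_add (Nat.mul_le_mul_right _ hP1) (Nat.mul_le_mul_left _ hP2)
    _ = (2 * 2 ^ cp n m) * (1 + c0 n m + 2 * cM n m) := by ring
    _ ≤ (2 * 2 ^ cp n m) * (3 * c0 n m) := Nat.mul_le_mul_left _ hsum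
    _ ≤ (2 * 2 ^ cp n m) * (3 * (3 * (n ^ 7 * m))) := Nat.mul_le_mul_left _ (Nat.mul_le_mul_left _ hc0)
    _ ≤ (2 * 2 ^ cp n m) * (16 * (2 ^ (7 * n) * 2 ^ m)) :=
        Nat.mul_le_mul_left _ (by nlinarith [Nat.mul_le_mul hn7 hm2])
    _ = 2 ^ (cp n m + 7 * n + m + 5) := by rw [show (16 : ℕ) = 2 ^ 4 from rfl]; ring

/-- `1 ≤ r`. [folklore] -/
theorem one_le_cr (hn : 1 ≤ n) (hm : 1 ≤ m) : 1 ≤ cr n m := by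
  unfold cr ck; exact Nat.mul_pos (one_le_cq hn hm) (Nat.succ_pos _)

/-- **`(nG)ʲ < 2^{cW}` for `j ≤ r`.** [folklore] -/
theorem pow_lt_two_pow_cW (hn : 1 ≤ n) (hm : 1 ≤ m) {j : ℕ} (hj : j ≤ cr n m) :
    ((n : ℤ) * cG n m) ^ j < 2 ^ cW n m := by
  have hG := cG_le_two_pow (n := n) (m := m) hn hm
  have hn2 : n ≤ 2 ^ n := Nat.lt_two_pow_self.le
  have hnG : n * cG n m ≤ 2 ^ (n + (cp n m + 7 * n + m + 5)) := by
    rw [pow_add]; exact Nat.mul_le_mul hn2 hG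
  have h1 : (n * cG n m) ^ j ≤ 2 ^ (cr n m * (n + (cp n m + 7 * n + m + 6))) := by
    calc (n * cG n m) ^ j ≤ (2 ^ (n + (cp n m + 7 * n + m + 5))) ^ j := Nat.pow_le_pow_left hnG j
      _ = 2 ^ ((n + (cp n m + 7 * n + m + 5)) * j) := by rw [pow_mul]
      _ ≤ 2 ^ (cr n m * (n + (cp n m + 7 * n + m + 6))) := by
          apply Nat.pow_le_pow_right (by norm_num)
          calc (n + (cp n m + 7 * n + m + 5)) * j ≤ (n + (cp n m + 7 * n + m + 6)) * cr n m :=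
                Nat.mul_le_mul (by omega) hj
            _ = cr n m * (n + (cp n m + 7 * n + m + 6)) := mul_comm _ _
  have h2 : (n * cG n m) ^ j < 2 ^ cW n m := by
    calc (n * cG n m) ^ j ≤ 2 ^ (cr n m * (n + (cp n m + 7 * n + m + 6))) := h1
      _ < 2 ^ cW n m := Nat.pow_lt_pow_right (by norm_num) (by unfold cW; omega)
  exact_mod_cast h2

/-- `G < 2^{cW}`. [folklore] -/
theorem cG_lt_two_pow_cW (hn : 1 ≤ n) (hm : 1 ≤ m) : (cG n m : ℤ) < 2 ^ cW n m := by
  have h := pow_lt_two_pow_cW (n := n) (m := m) hn hm (one_le_cr hn hm)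
  rw [pow_one] at h
  have hn1 : (1 : ℤ) ≤ n := by exact_mod_cast hn
  have hG0 : (0 : ℤ) ≤ (cG n m : ℤ) := Int.natCast_nonneg _
  nlinarith

/-- `2ᵖ + n + 1 < 2^{cW}`. [folklore] -/
theorem stepBound_lt_two_pow_cW (hn : 1 ≤ n) (hm : 1 ≤ m) : (2 : ℤ) ^ cp n m + n + 1 < 2 ^ cW n m := by
  have hG := cG_lt_two_pow_cW (n := n) (m := m) hn hm
  have h1 : (2 : ℤ) ^ cp n m + n + 1 ≤ (cG n m : ℤ) := by
    have hM2 : 1 ≤ 2 * cM n m := by have := one_le_cM hn hm; omega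
    have h := Nat.mul_le_mul_right (2 ^ cp n m + n + 1) hM2
    rw [one_mul] at h
    have : 2 ^ cp n m + n + 1 ≤ cG n m := by unfold cG; exact le_add_left h
    exact_mod_cast this
  exact lt_of_le_of_lt h1 hG

/-! ### The saturated run is the true run -/

/-- Widths `W ≥ cW` are large enough: monotonicity of `2ᵂ`. [folklore] -/
theorem two_pow_cW_le {W : ℕ} (hW : cW n m ≤ W) : (2 : ℤ) ^ cW n m ≤ 2 ^ W :=
  pow_le_pow_right₀ (by norm_num) hW

/-- **The saturated power loop computes the true powers**: `powCap W Nₜ j = Aₜʲ` for `j ≤ r`,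
`W ≥ cW`. [cite: Jaggi2011, §4, Thm. 18 (chunk p0022)] -/
theorem powCap_eq (hn : 1 ≤ n) (hm : 1 ≤ m) {W : ℕ} (hW : cW n m ≤ W) (t : ℕ) :
    ∀ j, j ≤ cr n m → powCap n m H W (fwIter n m H t) j = gradInt n m H (fwIter n m H t) ^ j
  | 0, _ => by rw [powCap, pow_zero]
  | j + 1, hj => by
    have hWle := two_pow_cW_le (n := n) (m := m) hW
    have hA : gradCap n m H W (fwIter n m H t) = gradInt n m H (fwIter n m H t) :=
      capM_of_abs_le (abs_gradInt_le hn hm t) ((cG_lt_two_pow_cW hn hm).trans_le hWle)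
    have hsymm : (gradInt n m H (fwIter n m H t) ^ j).IsSymm := (isSymm_gradInt (isSymm_fwIter t)).pow j
    rw [powCap, powCap_eq hn hm hW t j (Nat.le_of_succ_le hj), hA, mulRR_eq_mul hsymm, ← pow_succ']
    exact capM_of_abs_le (abs_pow_gradInt_le hn hm t (j + 1)) ((pow_lt_two_pow_cW hn hm hj).trans_le hWle)

/-- **The saturated iteration is the true iteration** for `W ≥ cW`.
[cite: Jaggi2011, Alg. 6 (chunk p0020)] -/
theorem iterCap_eq (hn : 1 ≤ n) (hm : 1 ≤ m) {W : ℕ} (hW : cW n m ≤ W) :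
    ∀ t, iterCap n m H W t = fwIter n m H t
  | 0 => rfl
  | t + 1 => by
    have hWle := two_pow_cW_le (n := n) (m := m) hW
    obtain ⟨-, -, hbd⟩ := fwIter_good (H := H) hn hm (t + 1)
    rw [iterCap, iterCap_eq hn hm hW t, stepCap, powCap_eq hn hm hW t (cr n m) le_rfl, fwIter]
    rw [fwIter] at hbd
    exact capM_of_abs_le hbd ((stepBound_lt_two_pow_cW hn hm).trans_le hWle)

/-- **The saturated output is the true output** for `W ≥ cW`. [folklore] -/
theorem thetaZCap_eq (hn : 1 ≤ n) (hm : 1 ≤ m) {W : ℕ} (hW : cW n m ≤ W) :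
    thetaZCap n m H W = thetaZ n m H := by
  rw [thetaZCap, iterCap_eq hn hm hW, thetaZ, fwFinal]

/-- **Specification of the saturated run** (`n, m ≥ 1`, `W ≥ cW`): the output `z = (thetaZCap W).toNat`
satisfies `m ϑ(H) ≤ z ≤ m ϑ(H) + 2`, and `thetaZCap W ≥ 0`.
[cite: GrotschelLovaszSchrijver1981, §6 (pp. 192–194)] [cite: Jaggi2011, Thm. 17 (chunk p0022)] -/
theorem thetaZCap_toNat_spec (hn : 1 ≤ n) (hm : 1 ≤ m) {W : ℕ} (hW : cW n m ≤ W) :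
    0 ≤ thetaZCap n m H W ∧
      (m : ℝ) * lovaszTheta H ≤ ((thetaZCap n m H W).toNat : ℝ) ∧
      (((thetaZCap n m H W).toNat : ℕ) : ℝ) ≤ m * lovaszTheta H + 2 := by
  rw [thetaZCap_eq hn hm hW]
  exact ⟨thetaZ_nonneg hn hm, thetaZ_toNat_spec hn hm⟩

end ThetaFW

end Literature.Combinatorics.SimpleGraph

end
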